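import Summits.HodgeConjecture.HodgeConjecture.Theses.DworkReflectionQuotients
import Literature.AlgebraicGeometry.HodgeTheory.DworkSexticTransportData

/-!
# Crux K2 `FlatClassesSpannedByReflectionInvariants` modulo the `Γ_W`-character of `H^{4,0}(X_ψ)`
# (types `j = 0, 2, 3`) and the purity of the one remaining type `(1,2,2,3,5,5)`

Route `route-HodgeConjecture-DworkReflectionQuotients` (cell `hodge-nonav`, rung F-H1 — never summit
credit), item `stmt-HodgeConjecture-20241`; landed `--supports stmt-HodgeConjecture-20241`. Prover seat
`hodge-nonav-20241-p1` (g3), 2026-08-27. CONDITIONAL results, with the conditions spelled out as explicit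
hypotheses (no named fact is used):

* `flatClassesSpannedByReflectionInvariants_of_topCharacter` — for `ψ⁶ ≠ 1` and `j ≠ 1`, the body of the crux
  for the flat types `(1,2,3,3,4,5)`, `(1,1,2,4,5,5)`, `(1,1,3,3,5,5)` (810 of the 1170 flat classes) follows
  from ONE statement about `X_ψ`: **the `Γ_W`-eigenclasses of `H⁴(X_ψ(ℂ); ℂ)` of non-trivial character and of
  Hodge type `(4,0)` vanish** (`TopCharacterTrivial ψ` below, inlined; i.e. `H^{4,0}(X_ψ) = ℂ·Res(Ω/F_ψ)`,
  on which `Γ_W` acts trivially — the Calabi–Yau sextic has `p_g = 1`; Griffiths' residues at pole order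
  ONE). Mechanism (tree, this seat): the `Γ_W`-equivariant real multiplicative transport along the Dwork
  line (`DworkSextic.exists_transportData`, Ehresmann in the family of `Γ_W`-invariant sextics), purity at
  the Fermat point by symmetry (`FermatSymmetricEigenlinesHodgeType`), and the Hodge–Riemann sign argument
  killing the `(3,1)`/`(1,3)`-parts (`DworkSexticFlatPiecesHodgeRiemannTransport`).
* `flatClassesSpannedByReflectionInvariants_of_topCharacter_of_typeOne` — **the whole route decl**
  `FlatClassesSpannedByReflectionInvariants` from that statement AND the purity `(2,2)` of the eigenclasses
  of the remaining type `(1,2,2,3,5,5) ∘ σ` / `(1,1,3,4,4,5) ∘ σ` (`j = 1`; not symmetric at the Fermat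
  point, so not reached by the transport argument; true by Griffiths' residue theorem at pole order two,
  `DworkSextic.isOfHodgeType_two_two_flatTypes_of_griffiths`).

Compare: `DworkReflectionQuotientsK2Singleton` (`j = 0`, unconditional), `…K2OfGriffiths` / `…K2ModuloKatz`
(all `j`, modulo a named fact).

## References

* N. M. Katz, *Another look at the Dwork family*, Progr. Math. 270 (2009), §3, Lemma 3.1. [Katz2009]
* C. Voisin, *Hodge Theory and Complex Algebraic Geometry I* (2002), §6.3.2 Thm. 6.32. [VoisinHodgeI2002]
* C. Voisin, *Hodge Theory and Complex Algebraic Geometry II* (2003), §3.1.2, §6.1.3. [VoisinHodgeII2003]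
* G. Bini, A. Garbagnati, *Quotients of the Dwork pencil*, J. Geom. Phys. 75 (2014), §3.4.
  [BiniGarbagnati2012]
-/

namespace Summit.HodgeConjecture.HodgeConjecture.Theorems

open Literature.AlgebraicGeometry.HodgeTheory Literature.AlgebraicGeometry.Motives
open Literature.AlgebraicTopology.SingularHomology

/-- **Crux K2 for the flat types `j = 0, 2, 3`, modulo the `Γ_W`-character of `H^{4,0}(X_ψ)`.** Let
`ψ⁶ ≠ 1` and suppose every `Γ_W`-eigenclass of `H⁴(X_ψ(ℂ); ℂ)` of non-trivial character whose pull-back to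
a Hodge model `A` is of type `(4,0)` vanishes (for all `A`). Then for `j ≠ 1`, `σ ∈ 𝔖₆` and every
rational `w = u + v` with `u` an eigenclass of exponent `e ∘ σ` and `v` one of exponent `(6 − e) ∘ σ`,
`e = DworkSextic.flatTypes j`, the class `w` lies in the `ℂ`-span of the rational `(2,2)`-classes fixed by
a realised reflection. One application of `DworkSextic.flatClasses_mem_span_reflInvariant_of_topCharacter`.
CONDITIONAL on the displayed hypothesis only (no named fact). [cite: Katz2009, §3 and Lemma 3.1]
[cite: VoisinHodgeI2002, §6.3.2 Thm. 6.32] [cite: BiniGarbagnati2012, §3.4] -/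
theorem flatClassesSpannedByReflectionInvariants_of_topCharacter
    {ψ : ℂ} (hψ : ψ ^ 6 ≠ 1)
    (hZ : ∀ (A : HodgeModel 4 (DworkSextic.fibre ψ)) (θ : DworkSextic.gammaW →* ℂˣ), θ ≠ 1 →
      ∀ x ∈ diagonalCharacterEigenspace (DworkSextic.form ψ) DworkSextic.gammaW θ (2 * 2),
        A.pullback (2 * 2) x ∈ A.hodgePQ (2 * 2) 4 0 → x = 0)
    (j : Fin 4) (hj : j ≠ 1) (σ : Equiv.Perm (Fin 6))
    (w : complexBetti (DworkSextic.fibre ψ) (2 * 2)) (hrat : IsRationalClass w)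
    (huv : ∃ u v : complexBetti (DworkSextic.fibre ψ) (2 * 2),
      DworkSextic.IsEig ψ (fun l => DworkSextic.flatTypes j (σ l)) u ∧
      DworkSextic.IsEig ψ (fun l => 6 - DworkSextic.flatTypes j (σ l)) v ∧ w = u + v) :
    w ∈ Submodule.span ℂ {c : complexBetti (DworkSextic.fibre ψ) (2 * 2) | IsRationalClass c ∧
      IsOfHodgeType 4 (DworkSextic.fibre ψ) (2 * 2) 2 2 c ∧ ∃ i i' : Fin 6, i ≠ i' ∧ ∃ ζ : ℂ, ζ ^ 6 = 1 ∧
        ∃ g : C(ComplexPoints (DworkSextic.fibre ψ), ComplexPoints (DworkSextic.fibre ψ)),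
          (∀ x, ∃ t : ℂ, (DworkSextic.pt ψ (g x)).rep = t • (fun k => if k = i then ζ * (DworkSextic.pt ψ x).rep i'
            else if k = i' then ζ⁻¹ * (DworkSextic.pt ψ x).rep i else (DworkSextic.pt ψ x).rep k)) ∧
          singularCohomology.map ℂ ℂ g (2 * 2) c = c} :=
  DworkSextic.flatClasses_mem_span_reflInvariant_of_topCharacter hψ j hj σ hZ w hrat huv

/-- **The route decl `FlatClassesSpannedByReflectionInvariants` modulo two explicit statements**: (1) for
every `ψ⁶ ≠ 1`, the `Γ_W`-eigenclasses of `H⁴(X_ψ(ℂ); ℂ)` of non-trivial character and type `(4,0)` vanish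
(the character of `H^{4,0}`; covers the types `j = 0, 2, 3` by the transport / Hodge–Riemann theorems); (2)
for every `ψ⁶ ≠ 1` and `σ`, the eigenclasses of the remaining flat type `(1,2,2,3,5,5) ∘ σ` and of its
conjugate `(6 − ·) ∘ σ` are of Hodge type `(2,2)` (the one type not symmetric at the Fermat point). Both
hypotheses are consequences of Griffiths' residue theorem (`DworkReflectionQuotientsK2OfGriffiths` needs it
at pole order two for ALL types; here pole order two is needed for type `j = 1` only). CONDITIONAL on the
two displayed hypotheses (no named fact). [cite: Katz2009, Lemma 3.1] [cite: VoisinHodgeII2003, §6.1.3]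
[cite: BiniGarbagnati2012, §3.4] -/
theorem flatClassesSpannedByReflectionInvariants_of_topCharacter_of_typeOne
    (hZ : ∀ ψ : ℂ, ψ ^ 6 ≠ 1 → ∀ (A : HodgeModel 4 (DworkSextic.fibre ψ)) (θ : DworkSextic.gammaW →* ℂˣ),
      θ ≠ 1 → ∀ x ∈ diagonalCharacterEigenspace (DworkSextic.form ψ) DworkSextic.gammaW θ (2 * 2),
        A.pullback (2 * 2) x ∈ A.hodgePQ (2 * 2) 4 0 → x = 0)
    (hJ1 : ∀ ψ : ℂ, ψ ^ 6 ≠ 1 → ∀ (σ : Equiv.Perm (Fin 6)) (u v : complexBetti (DworkSextic.fibre ψ) (2 * 2)),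
      DworkSextic.IsEig ψ (fun l => DworkSextic.flatTypes 1 (σ l)) u →
      DworkSextic.IsEig ψ (fun l => 6 - DworkSextic.flatTypes 1 (σ l)) v →
        IsOfHodgeType 4 (DworkSextic.fibre ψ) (2 * 2) 2 2 u ∧ IsOfHodgeType 4 (DworkSextic.fibre ψ) (2 * 2) 2 2 v) :
    Summit.HodgeConjecture.HodgeConjecture.Theses.DworkReflectionQuotients.FlatClassesSpannedByReflectionInvariants := by
  intro ψ hψ F X pt IsEig IsRefl j σ w hw huv
  by_cases hj : j = 1
  · subst hj
    obtain ⟨u, v, hu, hv, hwuv⟩ := huv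
    obtain ⟨hu2, hv2⟩ := hJ1 ψ hψ σ u v hu hv
    obtain ⟨hne, hne'⟩ := DworkSextic.flatTypes_zero_ne_five 1
    have hij : σ.symm 0 ≠ σ.symm 5 := fun h => by simpa using congrArg σ h
    exact DworkSextic.mem_span_reflInvariant_of_isEig_add hψ hij (e := fun l => DworkSextic.flatTypes 1 (σ l))
      (e' := fun l => 6 - DworkSextic.flatTypes 1 (σ l)) (by simpa using hne) (by simpa using hne') hu hv hwuv hw
      (hwuv ▸ hu2.add (DworkSextic.isSmoothProjective_fibre hψ) hv2)
  · exact DworkSextic.flatClasses_mem_span_reflInvariant_of_topCharacter hψ j hj σ (hZ ψ hψ) w hw huv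

end Summit.HodgeConjecture.HodgeConjecture.Theorems
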